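import Summits.HodgeConjecture.HodgeConjecture.Theorems.SmoothHypersurfaceGeometricGenusLe
import Summits.HodgeConjecture.HodgeConjecture.Theorems.SmoothHypersurfaceTopFormsVanish
import Summits.HodgeConjecture.HodgeConjecture.Theorems.SignSymmetricPowersFourFactsGeometricGenus
import Literature.AlgebraicGeometry.HodgeTheory.HodgeModelConnected

/-!
# The geometric genus of a smooth hypersurface: `h^{n,0}(X_F) = C(d-1, n+1)` — the named fact PG PROVED, and the K1-B stub `stub_genusBoundThreefold`

Prover seat `hodge-nonav-prover-Bx` (g11), cell `hodge-nonav`, programme PG-GENERAL, assembly. The named fact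
PG = `Literature.AlgebraicGeometry.HodgeTheory.Arapura2012_hypersurface_geometricGenus` — for every nonsingular form `F`
of degree `d ≥ 1` in `n + 2 ≥ 3` variables, `h^{n,0}(X_F) = C(d-1, n+1)` on the tree's Hodge structure
`BettiUniverse.hodge hHD hX n` — is PROVED here (`Arapura2012_hypersurface_geometricGenus_holds`):

* `d ≥ n + 2`: `SmoothHypersurfaceGeometricGenusLe.geometricGenus_eq_choose` (every holomorphic top form is a Griffiths
  residue — Serre's algebraisation on the affine charts — and the tree's lower bound `choose_le_geometricGenus`);
* `d ≤ n + 1`: `geometricGenus_eq_zero` — `h^{n,0}(X_F) = 0 = C(d-1, n+1)`, from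
  `SmoothHypersurfaceTopFormsVanish.finrank_holFormsInCharts_eq_zero` (a holomorphic top form is a global section of
  `𝒪_X(d-n-2)`, `d - n - 2 < 0`, on the compact connected `X^an`: zero) transported to the Hodge structure by
  `HodgeModel.ratPieceTopEquivForms`.

Consequences: `stub_genusBoundThreefold` — the REGISTERED stub (v15) of crux K1-B (stmt-HodgeConjecture-19716),
`h^{3,0}(X_f) ≤ C(d-1, 4)` for every nonsingular quinary form, VERBATIM and UNCONDITIONAL (the tree's
`SignSymmetricPowersFourFactsGeometricGenus.genusBound_of_geometricGenus` fed with PG); and PG is the binder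
`stub_hypersurfaceGeometricGenus` of crux K1-A (stmt-HodgeConjecture-19544), now dischargeable by
`Arapura2012_hypersurface_geometricGenus_holds`. Sorry-free; no definition, no named fact, no hypothesis of the form
`(h : NamedFact)`. Nothing here says HC ∕ HC_AV is proved: K1-B remains conditional on its other binders (hPL, h423,
hCDK, hB2) and rung F-H1 is not moved by this file.
-/

noncomputable section

set_option linter.dupNamespace false

open scoped Manifold ContDiff Topology LinearAlgebra.Projectivization
open Set Filter Function Projectivization

namespace Summit.HodgeConjecture.HodgeConjecture.Theorems.SmoothHypersurfaceGeometricGenus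

open Literature.AlgebraicGeometry.HodgeTheory Literature.AlgebraicGeometry.Motives Literature.NumberTheory.Transcendental
  Literature.Geometry.Kaehler Literature.AlgebraicTopology.CharacteristicClasses
  Summit.HodgeConjecture.HodgeConjecture.Theorems.SmoothHypersurfaceGeometricGenusLe
  Summit.HodgeConjecture.HodgeConjecture.Theorems.SmoothHypersurfaceTopFormsVanish
  Summit.HodgeConjecture.HodgeConjecture.Theorems.SignSymmetricPowersFourFactsGeometricGenus

/-! ### `Ωⁿ(X_F^an) = 0` for `d ≤ n + 1` -/

/-- **`dim_ℂ Ωⁿ(X_F^an) = 0`** for every Hodge model of the hypersurface `X_F` of a nonsingular form `F` of degree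
`1 ≤ d ≤ n + 1` in `n + 2 ≥ 3` variables (`SmoothHypersurfaceTopFormsVanish.finrank_holFormsInCharts_eq_zero` on the
compact connected carrier, `HodgeModel.connectedSpace_carrier`, with the coordinates `hypersurface_hodgeModel_coords`).
[cite: Hartshorne1977, II Example 8.20.3] [cite: Arapura2012, §17.3 (17.3.1)] -/
theorem finrank_holFormsInCharts_hodgeModel_eq_zero {n : ℕ} (hn : 1 ≤ n) {d : ℕ} (hd1 : 1 ≤ d) (hd : d ≤ n + 1)
    {F : MvPolynomial (Fin (n + 2)) ℂ} (hF : F.IsHomogeneous d) (hJ : SmoothHypersurface.IsNonsingularForm ℂ F)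
    (hX : IsSmoothProjective n (SmoothHypersurface.hypersurface F)) (A : HodgeModel n (SmoothHypersurface.hypersurface F)) :
    Module.finrank ℂ ↥(holFormsInCharts A.model A.carrier n) = 0 := by
  haveI : CompactSpace A.carrier := A.compactSpace_carrier hX
  haveI : ConnectedSpace A.carrier := A.connectedSpace_carrier hX
  obtain ⟨hψemb, hψrange, hhol, hjac⟩ := hypersurface_hodgeModel_coords hF hJ A
  exact finrank_holFormsInCharts_eq_zero
    (hypersurfacePoint (SmoothHypersurface.hypersurfaceι F) ∘ A.toComplexPoints) hF hd1 hd hψemb hψrange.le hjac hhol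
    A.finrank_model (by omega)

/-- **`h^{n,0}(X_F) = 0` for a nonsingular form of degree `1 ≤ d ≤ n + 1`** in `n + 2 ≥ 3` variables, on the tree's Hodge
structure `BettiUniverse.hodge hHD hX n` (`H^{n,0} = Θ_A⁻¹(H^{n,0}) ≅ Ωⁿ(X^an)`, `HodgeModel.ratPieceTopEquivForms`).
[cite: Arapura2012, §17.3 (17.3.1)] [cite: Hartshorne1977, II Example 8.20.3] -/
theorem geometricGenus_eq_zero (hHD : exists_isReal_hodgeModel) {n d : ℕ} (hn : 1 ≤ n) (hd1 : 1 ≤ d) (hd : d ≤ n + 1)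
    {F : MvPolynomial (Fin (n + 2)) ℂ} (hF : F.IsHomogeneous d) (hJ : SmoothHypersurface.IsNonsingularForm ℂ F)
    (hX : IsSmoothProjective n (SmoothHypersurface.hypersurface F)) :
    Module.finrank ℂ ↥((BettiUniverse.hodge hHD hX n).piece (n : ℤ) 0) = 0 := by
  set A := BettiUniverse.realHodgeModel hHD hX with hA
  have hp : (BettiUniverse.hodge hHD hX n).piece (n : ℤ) 0 = A.ratPiece hX n n 0 := by
    have h := A.piece_eq_ratPiece hX (BettiUniverse.realHodgeModel_isHodgeSymmetric hHD hX) (show n + 0 = n from rfl)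
    rw [Nat.cast_zero] at h
    exact h
  rw [hp, (A.ratPieceTopEquivForms hX (A.topHolFormClassPQ_bijective hX)).finrank_eq]
  exact finrank_holFormsInCharts_hodgeModel_eq_zero hn hd1 hd hF hJ hX A

/-! ### PG proved -/

/-- **The geometric genus of a smooth hypersurface (Arapura (17.3.1), Voisin II Cor. 6.12 at `p = 1`): the named fact
`Arapura2012_hypersurface_geometricGenus` PROVED** — `h^{n,0}(X_F) = C(d-1, n+1)` for every nonsingular form `F` of degree
`d ≥ 1` in `n + 2 ≥ 3` variables: `geometricGenus_eq_choose` for `d ≥ n + 2` and `geometricGenus_eq_zero` (with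
`C(d-1, n+1) = 0`) for `d ≤ n + 1`. [cite: Arapura2012, §17.3 (17.3.1)] [cite: VoisinHodgeII2003, §6.1.3 Cor. 6.12 (p = 1)] -/
theorem Arapura2012_hypersurface_geometricGenus_holds : Arapura2012_hypersurface_geometricGenus := by
  intro hHD n d hn hd F hF hJ hX
  by_cases hdn : n + 2 ≤ d
  · exact geometricGenus_eq_choose hHD hn hdn hF hJ hX
  · rw [geometricGenus_eq_zero hHD hn hd (by omega) hF hJ hX, Nat.choose_eq_zero_of_lt (by omega)]

/-! ### The K1-B stub -/

/-- **`h^{3,0}(X_f) ≤ C(d-1, 4)` for every nonsingular quinary form `f`** — the registered stub `stub_genusBoundThreefold`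
(v15) of crux K1-B (stmt-HodgeConjecture-19716), verbatim and unconditional: the tree's
`genusBound_of_geometricGenus` fed with `Arapura2012_hypersurface_geometricGenus_holds`.
[cite: Arapura2012, §17.3 (17.3.1)] -/
theorem stub_genusBoundThreefold : ∀ ⦃d : ℕ⦄ (f : MvPolynomial (Fin 5) ℂ), f.IsHomogeneous d →
    Literature.AlgebraicGeometry.Motives.SmoothHypersurface.IsNonsingularForm ℂ f →
    ∀ (hXF : Literature.AlgebraicGeometry.Motives.IsSmoothProjective 3
      (Literature.AlgebraicGeometry.Motives.SmoothHypersurface.hypersurface f)),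
    Module.finrank ℂ ↥((Literature.AlgebraicGeometry.HodgeTheory.BettiUniverse.hodge
      Literature.AlgebraicGeometry.HodgeTheory.exists_isReal_hodgeModel_holds hXF 3).piece 3 0) ≤ (d - 1).choose 4 :=
  genusBound_of_geometricGenus Arapura2012_hypersurface_geometricGenus_holds

/-- **The genus bound as a named theorem with explicit binders** (same content as `stub_genusBoundThreefold`).
[cite: Arapura2012, §17.3 (17.3.1)] -/
theorem genusBoundThreefold ⦃d : ℕ⦄ (f : MvPolynomial (Fin 5) ℂ) (hf : f.IsHomogeneous d)
    (hns : SmoothHypersurface.IsNonsingularForm ℂ f) (hXF : IsSmoothProjective 3 (SmoothHypersurface.hypersurface f)) :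
    Module.finrank ℂ ↥((BettiUniverse.hodge exists_isReal_hodgeModel_holds hXF 3).piece 3 0) ≤ (d - 1).choose 4 :=
  stub_genusBoundThreefold f hf hns hXF

end Summit.HodgeConjecture.HodgeConjecture.Theorems.SmoothHypersurfaceGeometricGenus

end
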